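import Mathlib

/-!
# Hard-core polymer gases: the partition function and Dobrushin's inductive bound

An abstract polymer system (Gruber–Kunz 1971; Kotecký–Preiss 1986; in the set-up of
Fernández–Procacci, Commun. Math. Phys. **274** (2007) 123, §2): a set `P` of *polymers* with a
reflexive symmetric *incompatibility* relation `inc` (`γ ≁ γ'`) and complex activities
`z : P → ℂ`. The partition function of a finite family `Λ` is the sum over its pairwise
compatible subfamilies, `Ξ_Λ(z) = Σ_{Λ' ⊆ Λ compatible} ∏_{γ ∈ Λ'} z γ` (FP07 eq. (2);
Friedli–Velenik Def. 5.2 with `δ ∈ {0, 1}`).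

Main result, fully proved (`polymerPartitionFunction_ne_zero_and_ratio_le`, *Dobrushin's criterion*,
condition (r.dob) of FP07 §2; R. L. Dobrushin, *Estimates of semi-invariants for the Ising
model at low temperatures*, Amer. Math. Soc. Transl. (2) **177** (1996) 59–81): if
`μ : P → ℝ`, `μ ≥ 0`, satisfies
`|z γ| ∏_{γ' ≁ γ} (1 + μ γ') ≤ μ γ` for every `γ` (the product over any finite set of polymers
incompatible with `γ`, which may include `γ` itself), then for every finite `Λ`
* `Ξ_Λ(z) ≠ 0`, and
* `|Ξ_{Λ ∖ {γ}}(z) / Ξ_Λ(z)| ≤ 1 + μ γ` for every `γ ∈ Λ`;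
hence `|Ξ_{Λ ∖ M} / Ξ_Λ| ≤ ∏_{γ ∈ M} (1 + μ γ) ≤ exp (Σ_{γ ∈ M} μ γ)`
(`norm_polymerPartitionFunction_sdiff_div_le`). The proof is Dobrushin's induction on `#Λ`
("no cluster
expansion"): `Ξ_Λ = Ξ_{Λ∖γ} + z γ · Ξ_{Λ ∖ N(γ)}` (`polymerPartitionFunction_insert`) and the ratio
`Ξ_{Λ∖N(γ)} / Ξ_{Λ∖γ}` is a telescoping product of one-polymer ratios in smaller families.

These ratio bounds are the input for uniform-in-volume estimates of expectations in
convergent expansions (e.g. the strong-coupling expansion of lattice gauge theory,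
Osterwalder–Seiler 1978 §3), where `Ξ_{Λ∖M}/Ξ_Λ` is the cost of excluding the polymers
touching a fixed finite region.

## Mathlib anchors

`Set.Pairwise` (with the `Finset`-coercion decidability instance of
`Mathlib/Data/Finset/Pairwise`), `Set.pairwise_insert_of_symm_of_notMem`, `Finset.powerset_insert`,
`Finset.sum_union`, `Finset.sum_image`, `Finset.strongInduction`, `Finset.prod_insert`, `norm_inv`,
`norm_sub_norm_le`.

## References

* R. Fernández, A. Procacci, *Cluster expansion for abstract polymer models. New bounds from an
  old approach*, Commun. Math. Phys. **274** (2007) 123–140, arXiv:math-ph/0605041, §2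
  (eqs. (2), (r.dob), (cdg.1), (cdg.3)). [FernandezProcacci2007]
* R. L. Dobrushin, *Estimates of semi-invariants for the Ising model at low temperatures*,
  in: Topics in Statistical and Theoretical Physics, AMS Transl. Ser. 2 **177** (1996) 59–81.
  [Dobrushin1996]
* S. Friedli, Y. Velenik, *Statistical Mechanics of Lattice Systems*, CUP (2017), §5.2
  (Def. 5.2) and Thm. 5.4. [FriedliVelenik2017]
-/

open Finset

namespace Literature.Probability.LatticeModels

variable {P : Type*} [DecidableEq P] (inc : P → P → Prop) [DecidableRel inc]

/-! ## Compatible families and the partition function -/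

/-- A finite family of polymers is *compatible* if its distinct members are pairwise
compatible (not `inc`-related): Mathlib's `Set.Pairwise` of the negated relation on the coerced
set (cf. `SimpleGraph.IsIndepSet`). [cite: FernandezProcacci2007, §2] -/
def IsCompatible (A : Finset P) : Prop := (A : Set P).Pairwise fun γ γ' => ¬ inc γ γ'

/-- Compatibility of a finite family is decidable (Mathlib's instance for `Set.Pairwise` on a
coerced `Finset`). [folklore] -/
instance (A : Finset P) : Decidable (IsCompatible inc A) :=
  inferInstanceAs (Decidable ((A : Set P).Pairwise fun γ γ' => ¬ inc γ γ'))

/-- **The polymer partition function** `Ξ_Λ(z) = Σ_{Λ' ⊆ Λ compatible} ∏_{γ ∈ Λ'} z γ` of the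
finite family `Λ` with activities `z` (Fernández–Procacci 2007 eq. (2); Friedli–Velenik
Def. 5.2 for hard-core interactions `δ ∈ {0,1}`). [cite: FernandezProcacci2007, eq. (2)] -/
def polymerPartitionFunction (z : P → ℂ) (Λ : Finset P) : ℂ :=
  ∑ A ∈ Λ.powerset, if IsCompatible inc A then ∏ γ ∈ A, z γ else 0

variable {inc}

omit [DecidableEq P] [DecidableRel inc] in
/-- Subfamilies of compatible families are compatible (`Set.Pairwise.mono`). [folklore] -/
theorem IsCompatible.mono {A B : Finset P} (h : IsCompatible inc B) (hAB : A ⊆ B) :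
    IsCompatible inc A :=
  Set.Pairwise.mono (Finset.coe_subset.2 hAB) h

omit [DecidableRel inc] in
/-- Adding a polymer compatible with every member keeps a family compatible, and conversely
(`Set.pairwise_insert_of_symm_of_notMem` for the symmetric negated relation). [folklore] -/
theorem isCompatible_insert (hsymm : ∀ γ γ', inc γ γ' → inc γ' γ) {γ : P} {B : Finset P}
    (hγ : γ ∉ B) :
    IsCompatible inc (insert γ B) ↔ IsCompatible inc B ∧ ∀ γ' ∈ B, ¬ inc γ γ' := by
  haveI : Std.Symm (fun γ γ' : P => ¬ inc γ γ') := ⟨fun a b h h' => h (hsymm b a h')⟩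
  unfold IsCompatible
  rw [Finset.coe_insert, Set.pairwise_insert_of_symm_of_notMem (Finset.mem_coe.not.2 hγ)]
  simp only [Finset.mem_coe]

/-- `Ξ_∅ = 1`. [folklore] -/
@[simp] theorem polymerPartitionFunction_empty (z : P → ℂ) :
    polymerPartitionFunction inc z ∅ = 1 := by
  simp [polymerPartitionFunction, IsCompatible]

/-- **The one-polymer recursion** `Ξ_{Λ ∪ {γ}} = Ξ_Λ + z γ · Ξ_{{γ' ∈ Λ : γ' ∼ γ}}` for
`γ ∉ Λ`: a compatible subfamily either avoids `γ` or consists of `γ` and a compatible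
subfamily of the polymers compatible with `γ` (Dobrushin 1996; Fernández–Procacci 2007 §2).
[cite: FernandezProcacci2007, §2] -/
theorem polymerPartitionFunction_insert (hsymm : ∀ γ γ', inc γ γ' → inc γ' γ) (z : P → ℂ) {γ : P}
    {Λ : Finset P} (hγ : γ ∉ Λ) :
    polymerPartitionFunction inc z (insert γ Λ) =
      polymerPartitionFunction inc z Λ +
        z γ * polymerPartitionFunction inc z (Λ.filter fun γ' => ¬ inc γ γ') := by
  have hdisj : Disjoint Λ.powerset (Λ.powerset.image (insert γ)) := by
    rw [disjoint_left]
    intro A hA hA'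
    obtain ⟨B, -, rfl⟩ := mem_image.1 hA'
    exact hγ (mem_powerset.1 hA (mem_insert_self γ B))
  have hinj : Set.InjOn (insert γ) (Λ.powerset : Set (Finset P)) := by
    intro A hA B hB hAB
    have hA' : γ ∉ A := fun h => hγ (mem_powerset.1 (mem_coe.1 hA) h)
    have hB' : γ ∉ B := fun h => hγ (mem_powerset.1 (mem_coe.1 hB) h)
    rw [← erase_insert hA', hAB, erase_insert hB']
  rw [polymerPartitionFunction, powerset_insert, sum_union hdisj, sum_image hinj]
  congr 1
  -- the families containing `γ`
  have hpow : (Λ.filter fun γ' => ¬ inc γ γ').powerset =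
      Λ.powerset.filter fun B => ∀ γ' ∈ B, ¬ inc γ γ' := by
    ext B
    simp only [mem_powerset, mem_filter, subset_iff]
    exact ⟨fun h => ⟨fun x hx => (h hx).1, fun x hx => (h hx).2⟩,
      fun h x hx => ⟨h.1 hx, h.2 x hx⟩⟩
  rw [polymerPartitionFunction, hpow, sum_filter, mul_sum]
  refine sum_congr rfl fun B hB => ?_
  have hγB : γ ∉ B := fun h => hγ (mem_powerset.1 hB h)
  by_cases h₁ : ∀ γ' ∈ B, ¬ inc γ γ'
  · have hiff : IsCompatible inc (insert γ B) ↔ IsCompatible inc B :=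
      (isCompatible_insert hsymm hγB).trans (and_iff_left h₁)
    rw [if_pos h₁]
    by_cases h₂ : IsCompatible inc B
    · rw [if_pos (hiff.2 h₂), if_pos h₂, prod_insert hγB]
    · rw [if_neg (fun h => h₂ (hiff.1 h)), if_neg h₂, mul_zero]
  · have hnc : ¬ IsCompatible inc (insert γ B) := fun h =>
      h₁ ((isCompatible_insert hsymm hγB).1 h).2
    rw [if_neg hnc, if_neg h₁, mul_zero]

/-- Removing a member: `Ξ_Λ = Ξ_{Λ∖γ} + z γ · Ξ_{{γ' ∈ Λ∖γ : γ' ∼ γ}}` for `γ ∈ Λ`.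
[cite: FernandezProcacci2007, §2] -/
theorem polymerPartitionFunction_eq_erase_add (hsymm : ∀ γ γ', inc γ γ' → inc γ' γ) (z : P → ℂ)
    {γ : P}
    {Λ : Finset P} (hγ : γ ∈ Λ) :
    polymerPartitionFunction inc z Λ = polymerPartitionFunction inc z (Λ.erase γ) +
      z γ * polymerPartitionFunction inc z ((Λ.erase γ).filter fun γ' => ¬ inc γ γ') := by
  conv_lhs => rw [← insert_erase hγ]
  exact polymerPartitionFunction_insert hsymm z (notMem_erase γ Λ)

/-! ## Dobrushin's criterion -/

/-- **Dobrushin's criterion for hard-core polymer gases** (Dobrushin 1996; Fernández–Procacci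
2007 §2, (r.dob) ⇒ (cdg.3), (cdg.1)). Let `inc` be reflexive and symmetric and let
`μ ≥ 0` satisfy `|z γ| · ∏_{γ' ∈ N} (1 + μ γ') ≤ μ γ` for every `γ` and every finite set `N`
of polymers incompatible with `γ` (possibly containing `γ`). Then for every finite family
`Λ`: `Ξ_Λ(z) ≠ 0`, and `|Ξ_{Λ∖γ}(z) / Ξ_Λ(z)| ≤ 1 + μ γ` for all `γ ∈ Λ`. (Induction on `#Λ`:
`Ξ_Λ / Ξ_{Λ∖γ} = 1 + z γ · Ξ_{Λ∖N(γ)} / Ξ_{Λ∖γ}` with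
`|Ξ_{Λ∖N(γ)} / Ξ_{Λ∖γ}| ≤ ∏_{γ' ∈ N(γ)∖γ} (1 + μ γ')`, so the criterion gives
`|Ξ_Λ / Ξ_{Λ∖γ} - 1| ≤ μ γ / (1 + μ γ) < 1`. This is Dobrushin's inductive statement; it is
sharper than what Fernández–Procacci print after (r.dob), namely (cdg.3) `ρ Π ≤ μ` and (cdg.1)
`|log (Ξ_Λ / Ξ_{Λ∖γ})| ≤ |z| Π`, i.e. ratio `≤ e^{μ γ}`.)
[cite: Dobrushin1996, §2 (inductive bound); condition (r.dob) of FernandezProcacci2007 §2] -/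
theorem polymerPartitionFunction_ne_zero_and_ratio_le (hrefl : ∀ γ, inc γ γ)
    (hsymm : ∀ γ γ', inc γ γ' → inc γ' γ) (z : P → ℂ) (μ : P → ℝ) (hμ : ∀ γ, 0 ≤ μ γ)
    (hD : ∀ (γ : P) (N : Finset P), (∀ γ' ∈ N, inc γ γ') →
      ‖z γ‖ * ∏ γ' ∈ N, (1 + μ γ') ≤ μ γ)
    (Λ : Finset P) :
    polymerPartitionFunction inc z Λ ≠ 0 ∧
      ∀ γ ∈ Λ, ‖polymerPartitionFunction inc z (Λ.erase γ) / polymerPartitionFunction inc z Λ‖ ≤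
        1 + μ γ := by
  induction Λ using Finset.strongInduction with
  | H Λ ih =>
    -- telescoping: removing a set `M` from a proper subfamily `B ⊂ Λ`
    have tele : ∀ B ⊂ Λ, ∀ M : Finset P,
        ‖polymerPartitionFunction inc z (B \ M) / polymerPartitionFunction inc z B‖ ≤
          ∏ γ' ∈ M, (1 + μ γ') := by
      intro B hB M
      induction M using Finset.induction_on with
      | empty => simp [(ih B hB).1]
      | @insert a M ha ihM =>
        have hBM : B \ M ⊂ Λ := lt_of_le_of_lt sdiff_le hB
        have hne : polymerPartitionFunction inc z (B \ M) ≠ 0 := (ih _ hBM).1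
        have hstep : ‖polymerPartitionFunction inc z ((B \ M).erase a) /
            polymerPartitionFunction inc z (B \ M)‖ ≤ 1 + μ a := by
          by_cases haB : a ∈ B \ M
          · exact (ih _ hBM).2 a haB
          · rw [erase_eq_of_notMem haB, div_self hne, norm_one]
            linarith [hμ a]
        have heq : polymerPartitionFunction inc z (B \ insert a M) /
              polymerPartitionFunction inc z B =
            polymerPartitionFunction inc z ((B \ M).erase a) /
                polymerPartitionFunction inc z (B \ M) *
              (polymerPartitionFunction inc z (B \ M) / polymerPartitionFunction inc z B) := by
          rw [sdiff_insert, div_mul_div_cancel₀ hne]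
        rw [heq, norm_mul, prod_insert ha]
        exact mul_le_mul hstep ihM (norm_nonneg _) (by linarith [hμ a])
    -- the one-polymer step at `γ ∈ Λ`
    have step : ∀ γ ∈ Λ, polymerPartitionFunction inc z (Λ.erase γ) ≠ 0 ∧
        ∃ w : ℂ, ‖w‖ * (1 + μ γ) ≤ μ γ ∧
          polymerPartitionFunction inc z Λ =
            polymerPartitionFunction inc z (Λ.erase γ) * (1 + w) := by
      intro γ hγ
      have hlt : Λ.erase γ ⊂ Λ := erase_ssubset hγ
      have hne : polymerPartitionFunction inc z (Λ.erase γ) ≠ 0 := (ih _ hlt).1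
      set M : Finset P := (Λ.erase γ).filter fun γ' => inc γ γ' with hM
      have hfilt : ((Λ.erase γ).filter fun γ' => ¬ inc γ γ') = Λ.erase γ \ M := by
        rw [hM, filter_not]
      refine ⟨hne, z γ * (polymerPartitionFunction inc z (Λ.erase γ \ M) /
        polymerPartitionFunction inc z (Λ.erase γ)),
        ?_, ?_⟩
      · -- Dobrushin's condition at `γ` with the incompatible set `insert γ M`
        have hγM : γ ∉ M := fun h => (notMem_erase γ Λ) (mem_filter.1 h).1
        have hcond := hD γ (insert γ M) (by
          intro γ' hγ'
          rcases mem_insert.1 hγ' with rfl | h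
          · exact hrefl _
          · exact (mem_filter.1 h).2)
        rw [prod_insert hγM] at hcond
        have hratio := tele _ hlt M
        have hz : 0 ≤ ‖z γ‖ := norm_nonneg _
        have hprod : 0 ≤ ∏ γ' ∈ M, (1 + μ γ') := prod_nonneg fun γ' _ => by linarith [hμ γ']
        calc ‖z γ * (polymerPartitionFunction inc z (Λ.erase γ \ M) /
                polymerPartitionFunction inc z (Λ.erase γ))‖ * (1 + μ γ)
            = ‖z γ‖ * ‖polymerPartitionFunction inc z (Λ.erase γ \ M) /
                polymerPartitionFunction inc z (Λ.erase γ)‖ *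
                (1 + μ γ) := by rw [norm_mul]
          _ ≤ ‖z γ‖ * (∏ γ' ∈ M, (1 + μ γ')) * (1 + μ γ) := by
              gcongr
              · linarith [hμ γ]
          _ = ‖z γ‖ * ((1 + μ γ) * ∏ γ' ∈ M, (1 + μ γ')) := by ring
          _ ≤ μ γ := hcond
      · rw [polymerPartitionFunction_eq_erase_add hsymm z hγ, hfilt]
        field_simp
    refine ⟨?_, fun γ hγ => ?_⟩
    · -- `Ξ_Λ ≠ 0`
      rcases Λ.eq_empty_or_nonempty with rfl | ⟨γ, hγ⟩
      · simp
      · obtain ⟨hne, w, hw, hΛ⟩ := step γ hγ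
        rw [hΛ]
        refine mul_ne_zero hne fun h => ?_
        have hw1 : ‖w‖ = 1 := by
          have : w = -1 := by linear_combination h
          rw [this, norm_neg, norm_one]
        rw [hw1, one_mul] at hw
        linarith [hμ γ]
    · -- the ratio bound
      obtain ⟨hne, w, hw, hΛ⟩ := step γ hγ
      have hw_lt : ‖w‖ < 1 := by
        by_contra h
        push Not at h
        have := hμ γ
        nlinarith [norm_nonneg w]
      have hlow : 1 - ‖w‖ ≤ ‖1 + w‖ := by
        have := norm_sub_norm_le (1 : ℂ) (-w)
        simpa [sub_neg_eq_add] using this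
      have hpos : 0 < 1 - ‖w‖ := by linarith
      have h1w : 1 + w ≠ 0 := by
        intro h
        rw [h, norm_zero] at hlow
        linarith
      rw [hΛ, div_mul_eq_div_div, div_self hne, one_div, norm_inv]
      calc ‖1 + w‖⁻¹ ≤ (1 - ‖w‖)⁻¹ := inv_anti₀ hpos hlow
        _ ≤ 1 + μ γ := by
            rw [inv_le_iff_one_le_mul₀ hpos]
            nlinarith [hw, hμ γ, norm_nonneg w]

/-- **Excluding a set of polymers**: under Dobrushin's criterion,
`|Ξ_{Λ ∖ M}(z) / Ξ_Λ(z)| ≤ ∏_{γ ∈ M} (1 + μ γ)` for all finite `Λ`, `M` (telescoping the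
one-polymer ratios; Fernández–Procacci 2007 §2, "a telescoping argument").
[cite: FernandezProcacci2007, §2] -/
theorem norm_polymerPartitionFunction_sdiff_div_le (hrefl : ∀ γ, inc γ γ)
    (hsymm : ∀ γ γ', inc γ γ' → inc γ' γ) (z : P → ℂ) (μ : P → ℝ) (hμ : ∀ γ, 0 ≤ μ γ)
    (hD : ∀ (γ : P) (N : Finset P), (∀ γ' ∈ N, inc γ γ') →
      ‖z γ‖ * ∏ γ' ∈ N, (1 + μ γ') ≤ μ γ)
    (Λ M : Finset P) :
    ‖polymerPartitionFunction inc z (Λ \ M) / polymerPartitionFunction inc z Λ‖ ≤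
      ∏ γ ∈ M, (1 + μ γ) := by
  induction M using Finset.induction_on with
  | empty => simp [(polymerPartitionFunction_ne_zero_and_ratio_le hrefl hsymm z μ hμ hD Λ).1]
  | @insert a M ha ih =>
    have key := polymerPartitionFunction_ne_zero_and_ratio_le hrefl hsymm z μ hμ hD (Λ \ M)
    have hstep : ‖polymerPartitionFunction inc z ((Λ \ M).erase a) /
        polymerPartitionFunction inc z (Λ \ M)‖ ≤ 1 + μ a := by
      by_cases haΛ : a ∈ Λ \ M
      · exact key.2 a haΛ
      · rw [erase_eq_of_notMem haΛ, div_self key.1, norm_one]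
        linarith [hμ a]
    have heq : polymerPartitionFunction inc z (Λ \ insert a M) / polymerPartitionFunction inc z Λ =
        polymerPartitionFunction inc z ((Λ \ M).erase a) / polymerPartitionFunction inc z (Λ \ M) *
          (polymerPartitionFunction inc z (Λ \ M) / polymerPartitionFunction inc z Λ) := by
      rw [sdiff_insert, div_mul_div_cancel₀ key.1]
    rw [heq, norm_mul, prod_insert ha]
    exact mul_le_mul hstep ih (norm_nonneg _) (by linarith [hμ a])

/-- The same bound in exponential form, `|Ξ_{Λ∖M} / Ξ_Λ| ≤ exp (Σ_{γ ∈ M} μ γ)`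
(`1 + x ≤ eˣ`). [folklore] -/
theorem norm_polymerPartitionFunction_sdiff_div_le_exp (hrefl : ∀ γ, inc γ γ)
    (hsymm : ∀ γ γ', inc γ γ' → inc γ' γ) (z : P → ℂ) (μ : P → ℝ) (hμ : ∀ γ, 0 ≤ μ γ)
    (hD : ∀ (γ : P) (N : Finset P), (∀ γ' ∈ N, inc γ γ') →
      ‖z γ‖ * ∏ γ' ∈ N, (1 + μ γ') ≤ μ γ)
    (Λ M : Finset P) :
    ‖polymerPartitionFunction inc z (Λ \ M) / polymerPartitionFunction inc z Λ‖ ≤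
      Real.exp (∑ γ ∈ M, μ γ) := by
  refine (norm_polymerPartitionFunction_sdiff_div_le hrefl hsymm z μ hμ hD Λ M).trans ?_
  rw [Real.exp_sum]
  exact prod_le_prod (fun γ _ => by linarith [hμ γ]) fun γ _ => by
    linarith [Real.add_one_le_exp (μ γ)]


end Literature.Probability.LatticeModels
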